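import Literature.Analysis.FluidPDE.ElgindiAngularSingularIntegral
import Literature.Analysis.FluidPDE.ElgindiGammaKNumerics
import HarnessLib

/-!
# The singular angular integrals `∫₀^{π/2} sin(2θ)^r dθ ≤ π/(r+1)` and
`∫₀^{π/2} Γ² sin(2θ)^{−η} dθ ≤ 100π` of Elgindi's `η`-weighted estimates ([Elgindi2021] §6.1–6.2)

Topic `Literature/Analysis/FluidPDE`. Proof file (everything proved, no definitions, no named
facts) on the proof path of the named fact
`Literature.Analysis.FluidPDE.Elgindi.ElgindiGhoulMasmoudi2021_stabilityCore`
(`ElgindiStabilityDecomposition.lean`). The coercivity estimates of T. M. Elgindi, Ann. of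
Math. 194 (2021) = arXiv:1904.04795 (`[Elgindi2021]`), §6.1 Prop. 6.7 / Cor. 6.8 and §6.2
Prop. 6.9 (p. 16–17 of the held text) pair the equation against the weight `w²/sin(2θ)^η`,
`η = 99/100` ("The reason for having two different angular weights comes from the elliptic
estimates"), and every `Γ`-term is then controlled through the finite singular integral
`∫₀^{π/2} Γ²sin(2θ)^{−η} dθ` (finite because `η < 1`; the bounds "`|I₃ w/√(sin(2θ)^η)|_{L²} ≤
(10/√(1−η))|fw|_{L²}`" of the proof of Prop. 6.9 display the `(1−η)^{−1/2}` loss). This file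
proves the quantitative bounds used by the vendored versions of these propositions:

* `sin_two_mul_rpow_le_add`: Jordan on both halves, `sin(2θ)^r ≤ ((4/π)θ)^r + ((4/π)(π/2−θ))^r`
  on `(0, π/2)` for `r ≤ 0`;
* `integral_sin_two_mul_rpow_le`: **`∫₀^{π/2} sin(2θ)^r dθ ≤ π/(r+1)`** for `−1 < r ≤ 0`, with
  integrability (`integrableOn_sin_two_mul_rpow`);
* `integral_angularWeight_sq_mul_rpow_eta_le`: **`∫₀^{π/2} Γ²sin(2θ)^{−η} dθ ≤ 100π`** (`Γ ≤ 1`,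
  `r = −η = −99/100`), `α ≥ 0`, with integrability.

Used: `integral_const_mul_rpow`, `integral_const_mul_sub_rpow` (`ElgindiAngularSingularIntegral.lean`).
-/

noncomputable section

open MeasureTheory Set Real intervalIntegral

namespace Literature.Analysis.FluidPDE

namespace Elgindi

/-- **Jordan's inequality on both halves of the quarter**: `sin(2θ)^r ≤ ((4/π)θ)^r +
((4/π)(π/2 − θ))^r` on `(0, π/2)` for `r ≤ 0`. [folklore] -/
theorem sin_two_mul_rpow_le_add {r : ℝ} (hr : r ≤ 0) {θ : ℝ} (hθ : θ ∈ Ioo 0 (π / 2)) :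
    Real.sin (2 * θ) ^ r ≤ (4 / π * θ) ^ r + (4 / π * (π / 2 - θ)) ^ r := by
  have n1 : 0 ≤ (4 / π * θ) ^ r := Real.rpow_nonneg (by have := hθ.1; positivity) _
  have n2 : 0 ≤ (4 / π * (π / 2 - θ)) ^ r := Real.rpow_nonneg (by
    have : 0 < π / 2 - θ := by linarith [hθ.2]
    positivity) _
  rcases le_or_gt θ (π / 4) with hle | hgt
  · have hj : 2 / π * (2 * θ) ≤ Real.sin (2 * θ) := Real.mul_le_sin (by linarith [hθ.1]) (by linarith)
    have hpos : 0 < 4 / π * θ := by have := hθ.1; positivity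
    have : Real.sin (2 * θ) ^ r ≤ (4 / π * θ) ^ r :=
      Real.rpow_le_rpow_of_nonpos hpos (by convert hj using 1; ring) hr
    linarith
  · have hj : 2 / π * (π - 2 * θ) ≤ Real.sin (π - 2 * θ) :=
      Real.mul_le_sin (by linarith [hθ.2]) (by linarith)
    rw [Real.sin_pi_sub] at hj
    have hpos : 0 < 4 / π * (π / 2 - θ) := by
      have : 0 < π / 2 - θ := by linarith [hθ.2]
      positivity
    have : Real.sin (2 * θ) ^ r ≤ (4 / π * (π / 2 - θ)) ^ r :=
      Real.rpow_le_rpow_of_nonpos hpos (by convert hj using 1; ring) hr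
    linarith

/-- `sin(2θ)^r` is integrable on `(0, π/2)` for `−1 < r ≤ 0`. [folklore] -/
theorem integrableOn_sin_two_mul_rpow {r : ℝ} (hr1 : -1 < r) (hr0 : r ≤ 0) :
    IntegrableOn (fun θ : ℝ => Real.sin (2 * θ) ^ r) (Ioo 0 (π / 2)) := by
  have iM : IntegrableOn (fun θ : ℝ => (4 / π * θ) ^ r + (4 / π * (π / 2 - θ)) ^ r) (Ioo 0 (π / 2)) :=
    (integrableOn_const_mul_rpow hr1).add (integrableOn_const_mul_sub_rpow hr1)
  have hm : Measurable fun θ : ℝ => Real.sin (2 * θ) ^ r := (by fun_prop : Measurable fun θ : ℝ =>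
    Real.sin (2 * θ)).pow_const _
  refine Integrable.mono' iM hm.aestronglyMeasurable ?_
  rw [ae_restrict_iff' measurableSet_Ioo]
  refine Filter.Eventually.of_forall fun θ hθ => ?_
  have hs : 0 < Real.sin (2 * θ) := Real.sin_pos_of_pos_of_lt_pi (by linarith [hθ.1]) (by linarith [hθ.2])
  rw [Real.norm_eq_abs, abs_of_nonneg (Real.rpow_nonneg hs.le _)]
  exact sin_two_mul_rpow_le_add hr0 hθ

/-- **`∫₀^{π/2} sin(2θ)^r dθ ≤ π/(r+1)`** for `−1 < r ≤ 0` (Jordan on both halves; each half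
integrates to `2^r(π/2)/(r+1) ≤ (π/2)/(r+1)`). [folklore] -/
theorem integral_sin_two_mul_rpow_le {r : ℝ} (hr1 : -1 < r) (hr0 : r ≤ 0) :
    ∫ θ in Ioo 0 (π / 2), Real.sin (2 * θ) ^ r ≤ π / (r + 1) := by
  have iM1 := integrableOn_const_mul_rpow hr1
  have iM2 := integrableOn_const_mul_sub_rpow hr1
  have hεpos : 0 < r + 1 := by linarith
  have h2r : (2 : ℝ) ^ r ≤ 1 := Real.rpow_le_one_of_one_le_of_nonpos (by norm_num) hr0
  have hIM : ∫ θ in Ioo 0 (π / 2), ((4 / π * θ) ^ r + (4 / π * (π / 2 - θ)) ^ r) =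
      2 * (2 ^ r * (π / 2) / (r + 1)) := by
    rw [integral_add iM1 iM2, ← integral_Ioc_eq_integral_Ioo,
      ← intervalIntegral.integral_of_le (by positivity), integral_const_mul_rpow hr1,
      ← integral_Ioc_eq_integral_Ioo, ← intervalIntegral.integral_of_le (by positivity),
      integral_const_mul_sub_rpow hr1]
    ring
  calc ∫ θ in Ioo 0 (π / 2), Real.sin (2 * θ) ^ r
      ≤ ∫ θ in Ioo 0 (π / 2), ((4 / π * θ) ^ r + (4 / π * (π / 2 - θ)) ^ r) :=
        setIntegral_mono_on (integrableOn_sin_two_mul_rpow hr1 hr0) (iM1.add iM2) measurableSet_Ioo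
          fun θ hθ => sin_two_mul_rpow_le_add hr0 hθ
    _ = 2 * (2 ^ r * (π / 2) / (r + 1)) := hIM
    _ ≤ 2 * (1 * (π / 2) / (r + 1)) := by gcongr
    _ = π / (r + 1) := by field_simp

/-- The `η`-weighted angular integrand `Γ²sin(2θ)^{−η}`, `η = 99/100`, is integrable on
`(0, π/2)` (`α ≥ 0`). [folklore] -/
theorem integrableOn_angularWeight_sq_mul_rpow_eta {α : ℝ} (hα : 0 ≤ α) :
    IntegrableOn (fun θ : ℝ => angularWeight α θ ^ 2 * Real.sin (2 * θ) ^ (-eta)) (Ioo 0 (π / 2)) := by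
  have hr1 : -1 < -eta := by unfold eta; norm_num
  have hr0 : -eta ≤ 0 := by unfold eta; norm_num
  have iM := integrableOn_sin_two_mul_rpow hr1 hr0
  have hm : Measurable fun θ : ℝ => angularWeight α θ ^ 2 * Real.sin (2 * θ) ^ (-eta) :=
    ((continuous_angularWeight hα).measurable.pow_const 2).mul
      ((by fun_prop : Measurable fun θ : ℝ => Real.sin (2 * θ)).pow_const _)
  refine Integrable.mono' iM hm.aestronglyMeasurable ?_
  rw [ae_restrict_iff' measurableSet_Ioo]
  refine Filter.Eventually.of_forall fun θ hθ => ?_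
  have hs : 0 < Real.sin (2 * θ) := Real.sin_pos_of_pos_of_lt_pi (by linarith [hθ.1]) (by linarith [hθ.2])
  have hρ : 0 ≤ Real.sin (2 * θ) ^ (-eta) := Real.rpow_nonneg hs.le _
  have h0 : 0 ≤ angularWeight α θ := angularWeight_nonneg α (Ioo_subset_Icc_self hθ)
  have h1 : angularWeight α θ ≤ 1 := angularWeight_le_one hα (Ioo_subset_Icc_self hθ)
  rw [Real.norm_eq_abs, abs_of_nonneg (mul_nonneg (sq_nonneg _) hρ)]
  calc angularWeight α θ ^ 2 * Real.sin (2 * θ) ^ (-eta) ≤ 1 * Real.sin (2 * θ) ^ (-eta) :=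
        mul_le_mul_of_nonneg_right (pow_le_one₀ h0 h1) hρ
    _ = Real.sin (2 * θ) ^ (-eta) := one_mul _

/-- **`∫₀^{π/2} Γ²sin(2θ)^{−η} dθ ≤ 100π`**, `η = 99/100`, `α ≥ 0` (`Γ ≤ 1` and
`∫sin(2θ)^{−η} ≤ π/(1 − η)`): the constant behind the `(1−η)^{−1/2}` losses of [Elgindi2021]
§6 (proof of Prop. 6.9: "`I₃` and `I₄` … contain `1/(1−η)` as a factor"). [cite: Elgindi2021, §6.2, proof of Proposition 6.9 (p. 17 of arXiv:1904.04795)] -/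
theorem integral_angularWeight_sq_mul_rpow_eta_le {α : ℝ} (hα : 0 ≤ α) :
    ∫ θ in Ioo 0 (π / 2), angularWeight α θ ^ 2 * Real.sin (2 * θ) ^ (-eta) ≤ 100 * π := by
  have hr1 : -1 < -eta := by unfold eta; norm_num
  have hr0 : -eta ≤ 0 := by unfold eta; norm_num
  have h1 : ∫ θ in Ioo 0 (π / 2), angularWeight α θ ^ 2 * Real.sin (2 * θ) ^ (-eta) ≤
      ∫ θ in Ioo 0 (π / 2), Real.sin (2 * θ) ^ (-eta) := by
    refine setIntegral_mono_on (integrableOn_angularWeight_sq_mul_rpow_eta hα)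
      (integrableOn_sin_two_mul_rpow hr1 hr0) measurableSet_Ioo fun θ hθ => ?_
    have hs : 0 < Real.sin (2 * θ) := Real.sin_pos_of_pos_of_lt_pi (by linarith [hθ.1]) (by linarith [hθ.2])
    have hρ : 0 ≤ Real.sin (2 * θ) ^ (-eta) := Real.rpow_nonneg hs.le _
    have h0 : 0 ≤ angularWeight α θ := angularWeight_nonneg α (Ioo_subset_Icc_self hθ)
    have h1 : angularWeight α θ ≤ 1 := angularWeight_le_one hα (Ioo_subset_Icc_self hθ)
    calc angularWeight α θ ^ 2 * Real.sin (2 * θ) ^ (-eta) ≤ 1 * Real.sin (2 * θ) ^ (-eta) :=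
          mul_le_mul_of_nonneg_right (pow_le_one₀ h0 h1) hρ
      _ = Real.sin (2 * θ) ^ (-eta) := one_mul _
  have h2 := integral_sin_two_mul_rpow_le hr1 hr0
  have h3 : π / (-eta + 1) = 100 * π := by unfold eta; ring
  linarith [h3 ▸ h2]

end Elgindi

end Literature.Analysis.FluidPDE
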